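import Literature.AlgebraicGeometry.Motives.MixedHodgeStructureJordanHolder
import Literature.AlgebraicGeometry.Motives.MixedHodgeExtension
import HarnessLib

/-!
# The length is additive on exact sequences of mixed Hodge structures

Sequel to `MixedHodgeStructureJordanHolder` (the Jordan–Hölder length `λ(H) = H.length`, additivity
`λ(S) + λ(H/S) = λ(H)` for a sub-MHS `S`). Beachy, *Introductory Lectures on Rings and Modules*, §2.5,
Def. 2.5.3 (the length) and Thm. 2.5.2 (Jordan–Hölder); Cattani–El Zein–Griffiths–Lê, *Hodge Theory*,
Thm. 3.2.18 (MHS form an abelian category: kernels, images, coimages, cokernels; `Coim f ⥲ Im f`) and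
Lemma 3.2.20. The length is therefore an additive function on the abelian category of MHS:

* §1 **rank–nullity `λ(Ker f) + λ(Im f) = λ(H)`** (`Hom.length_ker_add_length_range`, via the bijective
  morphism `coimageToRange : H/Ker f ⥲ Im f`), `λ(Im f) + λ(Coker f) = λ(H')`, monotonicity under injective /
  surjective morphisms (`length_le_of_injective`, `length_le_of_surjective`), `λ(Ker f) = λ(H) ↔ f = 0`, and for
  an endomorphism `λ(Ker f) = λ(Coker f)`.
* §2 **exact sequences**: `λ(H') = λ(Im f) + λ(Im g)` for `H → H' → H''` exact at `H'` (`length_eq_of_exact`),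
  subadditivity `λ(H') ≤ λ(H) + λ(H'')`, short exact sequences `λ(H') = λ(H) + λ(H'')` (`length_eq_add_of_exact`),
  and for the tree's extensions `0 → B → E → A → 0` (`Motives/MixedHodgeExtension`): **`λ(E) = λ(B) + λ(A)`**
  (`Extension.length_eq`).
* §3 small lengths: `λ(ℚ(j)) = 1`, rank one ⟹ `λ = 1`, `λ = 1 ⟹` pure, `1 ≤ λ(H)` for `H ≠ 0`.

All statements proved; no definitions, no named facts, no instances.

## References

* [Beachy1999RingsModules] J. A. Beachy, Introductory Lectures on Rings and Modules (1999), §2.5, Thm. 2.5.2,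
  Def. 2.5.3 (held text `book:beachy1999-introductory-lectures-rings-modules`, chunks p0098–p0099).
* [CattaniElZeinGriffithsLe2014] E. Cattani et al. (eds.), Hodge Theory (2014), Thm. 3.2.18, Lemma 3.2.20,
  Def. 3.2.15, p. 270.
-/

noncomputable section

namespace Literature.AlgebraicGeometry.Motives

namespace MixedHodgeStructure

universe u v w

variable {V : Type u} [AddCommGroup V] [Module ℚ V]
variable {V' : Type v} [AddCommGroup V'] [Module ℚ V']
variable {V'' : Type w} [AddCommGroup V''] [Module ℚ V'']
variable {H : MixedHodgeStructure V} {H' : MixedHodgeStructure V'} {H'' : MixedHodgeStructure V''}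

open SubMixedHodgeStructure

/-! ### §1 Rank–nullity for the length: `λ(H) = λ(Ker f) + λ(Im f)` -/

/-- `λ(S) = λ(H)` for a sub-MHS with underlying space `V` (its quotient is `0`). [cite: Beachy1999RingsModules, §2.5, Def. 2.5.3] -/
private theorem length_eq_of_toSubmodule_eq_top [FiniteDimensional ℚ V] {S : SubMixedHodgeStructure H}
    (hS : S.toSubmodule = ⊤) : S.toMixedHodgeStructure.length = H.length := by
  haveI : Subsingleton (V ⧸ S.toSubmodule) := Submodule.Quotient.subsingleton_iff.2 hS
  have h := S.length_add_length_quotient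
  rwa [length_eq_zero_iff.2 (inferInstance : Subsingleton (V ⧸ S.toSubmodule)), add_zero] at h

/-- The coimage `H / Ker f` of a morphism is the quotient MHS by the sub-MHS `Ker f` (by `rfl`).
[cite: CattaniElZeinGriffithsLe2014, Lemma 3.2.20] -/
theorem Hom.coimage_eq_ker_quotient (f : Hom H H') : f.coimage = f.ker.quotient := rfl

/-- **`λ(H / Ker f) = λ(Im f)`** (the coimage is isomorphic to the image, `coimageToRange`).
[cite: Beachy1999RingsModules, §2.5, Thm. 2.5.2 and Def. 2.5.3] [cite: CattaniElZeinGriffithsLe2014, Thm. 3.2.18] -/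
theorem Hom.length_ker_quotient [FiniteDimensional ℚ V] [FiniteDimensional ℚ V'] (f : Hom H H') :
    f.ker.quotient.length = f.range.toMixedHodgeStructure.length :=
  length_eq_of_bijective f.coimageToRange f.coimageToRange_bijective

/-- **Rank–nullity for the length: `λ(Ker f) + λ(Im f) = λ(H)`.** [cite: Beachy1999RingsModules, §2.5, Def. 2.5.3]
[cite: CattaniElZeinGriffithsLe2014, Thm. 3.2.18] -/
theorem Hom.length_ker_add_length_range [FiniteDimensional ℚ V] [FiniteDimensional ℚ V'] (f : Hom H H') :
    f.ker.toMixedHodgeStructure.length + f.range.toMixedHodgeStructure.length = H.length := by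
  rw [← f.length_ker_quotient]
  exact f.ker.length_add_length_quotient

/-- **`λ(Im f) + λ(Coker f) = λ(H')`.** [cite: Beachy1999RingsModules, §2.5, Def. 2.5.3] [cite: CattaniElZeinGriffithsLe2014, Thm. 3.2.18] -/
theorem Hom.length_range_add_length_coker [FiniteDimensional ℚ V'] (f : Hom H H') :
    f.range.toMixedHodgeStructure.length + f.coker.length = H'.length :=
  f.range.length_add_length_quotient

/-- `λ(Im f) ≤ λ(H)`. [cite: Beachy1999RingsModules, §2.5, Def. 2.5.3] -/
theorem Hom.length_range_le [FiniteDimensional ℚ V] [FiniteDimensional ℚ V'] (f : Hom H H') :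
    f.range.toMixedHodgeStructure.length ≤ H.length := by
  rw [← f.length_ker_add_length_range]
  exact Nat.le_add_left _ _

/-- `λ(Im f) ≤ λ(H')`. [cite: Beachy1999RingsModules, §2.5, Def. 2.5.3] -/
theorem Hom.length_range_le' [FiniteDimensional ℚ V'] (f : Hom H H') :
    f.range.toMixedHodgeStructure.length ≤ H'.length :=
  f.range.length_toMixedHodgeStructure_le

/-- **An injective morphism does not increase the length: `λ(H) ≤ λ(H')`.** [cite: Beachy1999RingsModules, §2.5, Def. 2.5.3] -/
theorem length_le_of_injective [FiniteDimensional ℚ V] [FiniteDimensional ℚ V'] (f : Hom H H')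
    (hf : Function.Injective f.toLinearMap) : H.length ≤ H'.length := by
  rw [length_eq_of_bijective f.rangeRestrict (f.rangeRestrict_bijective_of_injective hf)]
  exact f.range.length_toMixedHodgeStructure_le

/-- **A surjective morphism does not increase the length: `λ(H') ≤ λ(H)`.** [cite: Beachy1999RingsModules, §2.5, Def. 2.5.3] -/
theorem length_le_of_surjective [FiniteDimensional ℚ V] [FiniteDimensional ℚ V'] (f : Hom H H')
    (hf : Function.Surjective f.toLinearMap) : H'.length ≤ H.length := by
  have htop : f.range.toSubmodule = ⊤ := by rw [Hom.range_toSubmodule]; exact LinearMap.range_eq_top.2 hf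
  rw [← length_eq_of_toSubmodule_eq_top htop]
  exact f.length_range_le

/-- `λ(Ker f) = λ(H)` iff `f = 0`. [cite: Beachy1999RingsModules, §2.5, Def. 2.5.3] -/
theorem Hom.length_ker_eq_iff [FiniteDimensional ℚ V] [FiniteDimensional ℚ V'] (f : Hom H H') :
    f.ker.toMixedHodgeStructure.length = H.length ↔ f.toLinearMap = 0 := by
  constructor
  · intro h
    exact LinearMap.ker_eq_top.1 (f.ker.eq_top_of_length_eq h)
  · intro h
    exact length_eq_of_toSubmodule_eq_top (show f.ker.toSubmodule = ⊤ by rw [Hom.ker_toSubmodule, h, LinearMap.ker_zero])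

/-- **For an endomorphism, `λ(Ker f) = λ(Coker f)`** (`λ(Ker f) + λ(Im f) = λ(H) = λ(Im f) + λ(Coker f)`).
[cite: Beachy1999RingsModules, §2.5, Def. 2.5.3] [cite: CattaniElZeinGriffithsLe2014, Thm. 3.2.18] -/
theorem Hom.length_ker_eq_length_coker [FiniteDimensional ℚ V] (f : Hom H H) :
    f.ker.toMixedHodgeStructure.length = f.coker.length := by
  have h₁ := f.length_ker_add_length_range
  have h₂ := f.length_range_add_length_coker
  omega

/-! ### §2 Short exact sequences and extensions: `λ(E) = λ(A) + λ(B)` -/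

/-- **The length is additive on short exact sequences**: if `i : H → E` is injective, `p : E → H''` is
surjective and `Im i = Ker p`, then `λ(E) = λ(H) + λ(H'')`. [cite: Beachy1999RingsModules, §2.5, Def. 2.5.3 and Thm. 2.5.2]
[cite: CattaniElZeinGriffithsLe2014, Thm. 3.2.18] -/
theorem length_eq_add_of_exact [FiniteDimensional ℚ V] [FiniteDimensional ℚ V'] [FiniteDimensional ℚ V'']
    (i : Hom H H') (p : Hom H' H'') (hi : Function.Injective i.toLinearMap) (hp : Function.Surjective p.toLinearMap)
    (h : Function.Exact i.toLinearMap p.toLinearMap) : H'.length = H.length + H''.length := by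
  have hker : p.ker = i.range :=
    SubMixedHodgeStructure.ext (by rw [Hom.ker_toSubmodule, Hom.range_toSubmodule]; exact (LinearMap.exact_iff.1 h))
  have htop : p.range.toSubmodule = ⊤ := by rw [Hom.range_toSubmodule]; exact LinearMap.range_eq_top.2 hp
  rw [← p.length_ker_add_length_range, hker,
    ← length_eq_of_bijective i.rangeRestrict (i.rangeRestrict_bijective_of_injective hi),
    length_eq_of_toSubmodule_eq_top htop]

/-- **Exactness at the middle term: `λ(H') = λ(Im f) + λ(Im g)`** for `H → H' → H''` exact at `H'`
(`Ker g = Im f` and rank–nullity for `g`). [cite: Beachy1999RingsModules, §2.5, Def. 2.5.3] [cite: CattaniElZeinGriffithsLe2014, Thm. 3.2.18] -/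
theorem length_eq_of_exact [FiniteDimensional ℚ V'] [FiniteDimensional ℚ V''] (f : Hom H H') (g : Hom H' H'')
    (h : Function.Exact f.toLinearMap g.toLinearMap) :
    H'.length = f.range.toMixedHodgeStructure.length + g.range.toMixedHodgeStructure.length := by
  have hker : g.ker = f.range :=
    SubMixedHodgeStructure.ext (by rw [Hom.ker_toSubmodule, Hom.range_toSubmodule]; exact (LinearMap.exact_iff.1 h))
  rw [← g.length_ker_add_length_range, hker]

/-- **Subadditivity along an exact sequence: `λ(H') ≤ λ(H) + λ(H'')`** for `H → H' → H''` exact at `H'`.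
[cite: Beachy1999RingsModules, §2.5, Def. 2.5.3] [cite: CattaniElZeinGriffithsLe2014, Thm. 3.2.18] -/
theorem length_le_add_of_exact [FiniteDimensional ℚ V] [FiniteDimensional ℚ V'] [FiniteDimensional ℚ V'']
    (f : Hom H H') (g : Hom H' H'') (h : Function.Exact f.toLinearMap g.toLinearMap) :
    H'.length ≤ H.length + H''.length := by
  rw [length_eq_of_exact f g h]
  exact Nat.add_le_add f.length_range_le g.length_range_le'

/-- **`λ(E) = λ(A) + λ(B)` for an extension `0 → B → E → A → 0` of mixed Hodge structures.**
[cite: Beachy1999RingsModules, §2.5, Def. 2.5.3] [cite: CattaniElZeinGriffithsLe2014, Thm. 3.2.18] -/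
theorem Extension.length_eq {VA : Type u} [AddCommGroup VA] [Module ℚ VA] [FiniteDimensional ℚ VA]
    {VB : Type v} [AddCommGroup VB] [Module ℚ VB] [FiniteDimensional ℚ VB]
    {VE : Type w} [AddCommGroup VE] [Module ℚ VE] [FiniteDimensional ℚ VE]
    {A : MixedHodgeStructure VA} {B : MixedHodgeStructure VB} (E : Extension A B VE) :
    E.mhs.length = B.length + A.length :=
  length_eq_add_of_exact E.inc E.proj E.injective_inc E.surjective_proj E.exact

/-! ### §3 Small lengths: Tate structures, rank one, length one -/

/-- **`λ(ℚ(j)) = 1`.** [cite: CattaniElZeinGriffithsLe2014, p. 270 and Def. 3.2.15] -/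
theorem length_tate (j : ℤ) : (HodgeStructure.tate j).toMixedHodgeStructure.length = 1 :=
  length_eq_one_iff.2 (isSimple_tate j)

/-- A mixed Hodge structure of rank one has length one. [cite: CattaniElZeinGriffithsLe2014, p. 270] -/
theorem length_eq_one_of_finrank_eq_one [FiniteDimensional ℚ V] (hV : Module.finrank ℚ V = 1) (H : MixedHodgeStructure V) :
    H.length = 1 :=
  length_eq_one_iff.2 (isSimple_of_finrank_eq_one hV H)

/-- A mixed Hodge structure of length one is pure (a simple MHS is pure). [cite: CattaniElZeinGriffithsLe2014, p. 270] -/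
theorem exists_isPure_of_length_eq_one [FiniteDimensional ℚ V] (h : H.length = 1) : ∃ n, H.IsPure n :=
  (length_eq_one_iff.1 h).exists_isPure

/-- `1 ≤ λ(H)` for `H ≠ 0`. [cite: Beachy1999RingsModules, §2.5, Def. 2.5.3] -/
theorem one_le_length [FiniteDimensional ℚ V] [Nontrivial V] (H : MixedHodgeStructure V) : 1 ≤ H.length :=
  length_pos_iff.2 inferInstance

end MixedHodgeStructure

end Literature.AlgebraicGeometry.Motives
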